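import Summits.QuantumFields.YangMills.Theorems.LuscherReductionDressedRitzPolyakovLiftTransplantParity
import Literature.Analysis.OperatorTheory.YangMillsMatrixModelGroundStateReflection
import HarnessLib

/-!
# Line «polyakovlift» r6 on crux `DressedRitz` (stmt-QuantumFields-20205): S-STAT″ (o2) — AXIS REFLECTIONS `R_k` (one link inverted ↔ one row of `ℝ⁹` negated)

Fleet-service module of seat ym-infvol-p1 g7; sequel of `…PolyakovLiftTransplantParity.lean` (axis transpositions, total parity).  The third family of generators of the
hyperoctahedral lift symmetries, the axis reflections `R_k V = (V_k ↦ V_k⁻¹)` (`isLiftSymmetry_axisReflect`, p545957), act on the root chart by the row sign flip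
`x_k ↦ −x_k` (Literature `YangMillsMatrixModelGroundStateReflection`, under which the positive ground state `f_0` is invariant):

* `axisReflect_involutive`, ★ `rootCoord_axisReflect` (`rootCoord L μ (R_k V) = (x_k ↦ −x_k)(rootCoord L μ V)`);
* ★★ `pairSeparated_transplantObsL_reflect` — `f_{i+1}` even and `f_{l+1}` odd under `x_k ↦ −x_k` (or vice versa) ⇒ `PairSeparated (g_i) (g_l)`;
* ★★ `staticClauses_transplantL_of_hyperoctCert` — BOTH static clauses, every `C ≥ 0`, for the transplant basis of an AL1 family every excited pair of which is
  separated by a sign under SOME generator of the hyperoctahedral group (transposition `x_a ↔ x_b`, reflection `x_k ↦ −x_k`, or parity `x ↦ −x`),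
  `β ≥ 1`, `12·physLevel(k+1)·Λ < 1`, `1 ≤ R`, `1/8 ≤ RΛ ≤ 1/4`.

HONEST FRAMING: fixed-lattice symmetry bookkeeping on the conditional femto rung R2b1; the certificate for concrete AL1 families (isotype content of the low levels of `𝔥`)
is an open ONE-type classification; RG content above the first repeated isotype untouched; not infinite volume, not a gap, not Clay.
References: M. Lüscher, NPB 219 (1983) 233 [cite: Luscher1983, §2–§3]; M. Lüscher, U. Wolff, NPB 339 (1990) 222 [cite: LuscherWolff1990].
-/

set_option autoImplicit false

noncomputable section

open MeasureTheory Filter Topology Real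
open Literature.MathematicalPhysics.QuantumFieldTheory (GaugeConfig Site gaugeTransform configPerm configPerm_apply sitePerm)
open Literature.Analysis.OperatorTheory.YMMatrixModel
open scoped BigOperators

namespace Summit.QuantumFields.YangMills.Theorems.FemtoTransferGap.PolyakovLift

open Summit.QuantumFields.YangMills.Theorems.FemtoTransferGap

variable {k : ℕ}

/-! ## §1 The axis reflection on the root chart -/

/-- `R_k` on a named link: `(R_k V)(e_i) = V(e_i)⁻¹` if `i = k`, else `V(e_i)`. [folklore] -/
theorem axisReflect_edgeOf (kx : Fin 3) (V : Cfg) (i : Fin 3) :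
    configPerm (Equiv.swap 0 kx) ((configPerm (Equiv.swap 0 kx) V).negReflect) (edgeOf i) = if i = kx then (V (edgeOf i))⁻¹ else V (edgeOf i) :=
  axisReflect_one_site_apply kx V _ i

/-- `R_k` is an involution. [folklore] -/
theorem axisReflect_involutive (kx : Fin 3) (V : Cfg) :
    configPerm (Equiv.swap 0 kx) ((configPerm (Equiv.swap 0 kx) (configPerm (Equiv.swap 0 kx) ((configPerm (Equiv.swap 0 kx) V).negReflect))).negReflect) = V := by
  funext e
  obtain ⟨x, μ⟩ := e
  rw [axisReflect_one_site_apply, axisReflect_one_site_apply]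
  split_ifs with h
  · exact inv_inv _
  · rfl

/-- The gnomonic chart sends `R_k` to the row sign flip `x_k ↦ −x_k`. [cite: Luscher1983, §2] -/
theorem gnCoord_axisReflect (μ : ℝ) (kx : Fin 3) (V : Cfg) :
    gnCoord μ (configPerm (Equiv.swap 0 kx) ((configPerm (Equiv.swap 0 kx) V).negReflect)) =
      LinearIsometryEquiv.piLpCongrRight 2
        (fun q : Fin 3 × Fin 3 => if q.1 = kx then LinearIsometryEquiv.neg ℝ (E := ℝ) else LinearIsometryEquiv.refl ℝ ℝ) (gnCoord μ V) := by
  ext p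
  rw [gnCoord_apply, rowNeg_apply, gnCoord_apply, axisReflect_edgeOf]
  by_cases h : p.1 = kx
  · rw [if_pos h, if_pos h, gnLink_inv, neg_div]
  · rw [if_neg h, if_neg h]

/-- Row sign flips preserve the link norms. [folklore] -/
theorem linkNormSq_rowNeg (kx : Fin 3) (y : ZM) (i : Fin 3) :
    linkNormSq (LinearIsometryEquiv.piLpCongrRight 2
        (fun q : Fin 3 × Fin 3 => if q.1 = kx then LinearIsometryEquiv.neg ℝ (E := ℝ) else LinearIsometryEquiv.refl ℝ ℝ) y) i = linkNormSq y i := by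
  unfold linkNormSq
  refine Finset.sum_congr rfl fun a _ => ?_
  rw [rowNeg_apply]
  split_ifs
  · exact neg_sq _
  · rfl

/-- The root rescaling commutes with row sign flips. [folklore] -/
theorem rootRescale_rowNeg (L : ℕ) (μ : ℝ) (kx : Fin 3) (y : ZM) :
    rootRescale L μ (LinearIsometryEquiv.piLpCongrRight 2
        (fun q : Fin 3 × Fin 3 => if q.1 = kx then LinearIsometryEquiv.neg ℝ (E := ℝ) else LinearIsometryEquiv.refl ℝ ℝ) y) =
      LinearIsometryEquiv.piLpCongrRight 2
        (fun q : Fin 3 × Fin 3 => if q.1 = kx then LinearIsometryEquiv.neg ℝ (E := ℝ) else LinearIsometryEquiv.refl ℝ ℝ) (rootRescale L μ y) := by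
  ext p
  rw [rootRescale_apply, linkNormSq_rowNeg, rowNeg_apply, rowNeg_apply, rootRescale_apply]
  split_ifs
  · exact mul_neg _ _
  · rfl

/-- ★ **The root chart sends the axis reflection `R_k` to the row sign flip `x_k ↦ −x_k`.** [cite: Luscher1983, §2] -/
theorem rootCoord_axisReflect (L : ℕ) (μ : ℝ) (kx : Fin 3) (V : Cfg) :
    rootCoord L μ (configPerm (Equiv.swap 0 kx) ((configPerm (Equiv.swap 0 kx) V).negReflect)) =
      LinearIsometryEquiv.piLpCongrRight 2
        (fun q : Fin 3 × Fin 3 => if q.1 = kx then LinearIsometryEquiv.neg ℝ (E := ℝ) else LinearIsometryEquiv.refl ℝ ℝ) (rootCoord L μ V) := by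
  unfold rootCoord
  rw [gnCoord_axisReflect, rootRescale_rowNeg]

/-! ## §2 Separated pairs from reflection signs -/

/-- The ground state of an AL1 family with `f_0 > 0` is invariant under row sign flips. [cite: Luscher1983, §2] [cite: ReedSimonIV1978, Thm. XIII.47–48] -/
theorem groundState_rowNeg_of_isEigenFamily {f : Fin (k + 1) → ZM → ℝ} (hf : IsEigenFamily k f) (hpos : ∀ x, 0 < f 0 x) (kx : Fin 3) (y : ZM) :
    f 0 (LinearIsometryEquiv.piLpCongrRight 2
        (fun q : Fin 3 × Fin 3 => if q.1 = kx then LinearIsometryEquiv.neg ℝ (E := ℝ) else LinearIsometryEquiv.refl ℝ ℝ) y) = f 0 y := by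
  obtain ⟨C, -, hC⟩ := (hf.2.2.2.2 0).exists_abs_le
  have heig : ∀ x, hApply (f 0) x = physLevel 1 * f 0 x := fun x => by have h := hf.2.2.2.1 0 x; simpa using h
  have hnorm : ∫ x, f 0 x * f 0 x = (1 : ℝ) := by have h := hf.2.2.1 0 0; rwa [if_pos rfl] at h
  exact groundState_rowNeg kx (contDiff_two_of_forall (hf.1 0)) (hf.2.1 0) heig ⟨C, hC⟩ hnorm hpos y

/-- ★★ **Reflection-separated pairs are `PairSeparated`**: if `f_{i+1}` is EVEN and `f_{l+1}` ODD under `x_k ↦ −x_k` (or vice versa), the transplanted channels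
`g_i, g_l` are separated by the axis reflection `R_k`. [cite: Luscher1983, §2–§3] [cite: LuscherWolff1990] -/
theorem pairSeparated_transplantObsL_reflect (L : ℕ) (Λ R : ℝ) {f : Fin (k + 1) → ZM → ℝ} (hf : IsEigenFamily k f) (hpos : ∀ x, 0 < f 0 x)
    (kx : Fin 3) {i l : Fin k}
    (hsign : ((∀ y, f i.succ (LinearIsometryEquiv.piLpCongrRight 2
          (fun q : Fin 3 × Fin 3 => if q.1 = kx then LinearIsometryEquiv.neg ℝ (E := ℝ) else LinearIsometryEquiv.refl ℝ ℝ) y) = f i.succ y) ∧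
        (∀ y, f l.succ (LinearIsometryEquiv.piLpCongrRight 2
          (fun q : Fin 3 × Fin 3 => if q.1 = kx then LinearIsometryEquiv.neg ℝ (E := ℝ) else LinearIsometryEquiv.refl ℝ ℝ) y) = -f l.succ y)) ∨
      ((∀ y, f l.succ (LinearIsometryEquiv.piLpCongrRight 2
          (fun q : Fin 3 × Fin 3 => if q.1 = kx then LinearIsometryEquiv.neg ℝ (E := ℝ) else LinearIsometryEquiv.refl ℝ ℝ) y) = f l.succ y) ∧
        (∀ y, f i.succ (LinearIsometryEquiv.piLpCongrRight 2
          (fun q : Fin 3 × Fin 3 => if q.1 = kx then LinearIsometryEquiv.neg ℝ (E := ℝ) else LinearIsometryEquiv.refl ℝ ℝ) y) = -f i.succ y))) :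
    PairSeparated (transplantObsL L Λ R f i) (transplantObsL L Λ R f l) := by
  set S := LinearIsometryEquiv.piLpCongrRight 2
    (fun q : Fin 3 × Fin 3 => if q.1 = kx then LinearIsometryEquiv.neg ℝ (E := ℝ) else LinearIsometryEquiv.refl ℝ ℝ) with hSdef
  have hS : ∀ U : Cfg, rootCoord L (Λ / 2) (configPerm (Equiv.swap 0 kx) ((configPerm (Equiv.swap 0 kx) U).negReflect)) = S (rootCoord L (Λ / 2) U) :=
    fun U => rootCoord_axisReflect L (Λ / 2) kx U
  have hnorm : ∀ y, ‖S y‖ = ‖y‖ := fun y => S.norm_map y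
  have h0 : ∀ y, f 0 (S y) = f 0 y := fun y => groundState_rowNeg_of_isEigenFamily hf hpos kx y
  refine Or.inl ⟨fun V => configPerm (Equiv.swap 0 kx) ((configPerm (Equiv.swap 0 kx) V).negReflect), isLiftSymmetry_axisReflect kx,
    axisReflect_involutive kx, ?_⟩
  rcases hsign with ⟨hi, hl⟩ | ⟨hl, hi⟩
  · refine Or.inl ⟨fun V => ?_, fun V => ?_⟩
    · have := transplantObsL_comp_of_equivariant (R := R) hS hnorm h0 (ε := 1) (fun y => by rw [hi y, one_mul]) V
      rw [this, one_mul]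
    · have := transplantObsL_comp_of_equivariant (R := R) hS hnorm h0 (ε := -1) (fun y => by rw [hl y, neg_one_mul]) V
      rw [this, neg_one_mul]
  · refine Or.inr ⟨fun V => ?_, fun V => ?_⟩
    · have := transplantObsL_comp_of_equivariant (R := R) hS hnorm h0 (ε := 1) (fun y => by rw [hl y, one_mul]) V
      rw [this, one_mul]
    · have := transplantObsL_comp_of_equivariant (R := R) hS hnorm h0 (ε := -1) (fun y => by rw [hi y, neg_one_mul]) V
      rw [this, neg_one_mul]

/-! ## §3 ★★ S-STAT″ for hyperoctahedrally separated AL1 families -/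

/-- ★★ **Both static clauses, every `C ≥ 0`, for the transplant basis of an AL1 family every excited pair of which carries opposite signs under SOME generator of the
hyperoctahedral symmetry** — a transposition `x_a ↔ x_b`, a reflection `x_k ↦ −x_k`, or the parity `x ↦ −x`. [cite: Luscher1983, §3] [cite: LuscherWolff1990] -/
theorem staticClauses_transplantL_of_hyperoctCert {L : ℕ} [NeZero L] {β : ℝ} (hβ : 1 ≤ β) {φ : GaugeConfig 3 L SU2 → ℝ} (hvac : IsRawVacuum β φ)
    {Λ R : ℝ} (hΛ : 0 < Λ) (hΛk : 12 * physLevel (k + 1) * Λ < 1) (hR1 : 1 ≤ R) (hlo : 1 / 8 ≤ R * Λ) (hhi : R * Λ ≤ 1 / 4)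
    {f : Fin (k + 1) → ZM → ℝ} (hf : IsEigenFamily k f) (hpos : ∀ x, 0 < f 0 x)
    (hcert : ∀ i l : Fin k, i ≠ l →
      (∃ a b : Fin 3,
        ((∀ y, f i.succ (LinearIsometryEquiv.piLpCongrLeft 2 ℝ ℝ ((Equiv.swap a b).prodCongr (Equiv.refl (Fin 3))) y) = f i.succ y) ∧
            (∀ y, f l.succ (LinearIsometryEquiv.piLpCongrLeft 2 ℝ ℝ ((Equiv.swap a b).prodCongr (Equiv.refl (Fin 3))) y) = -f l.succ y)) ∨
          ((∀ y, f l.succ (LinearIsometryEquiv.piLpCongrLeft 2 ℝ ℝ ((Equiv.swap a b).prodCongr (Equiv.refl (Fin 3))) y) = f l.succ y) ∧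
            (∀ y, f i.succ (LinearIsometryEquiv.piLpCongrLeft 2 ℝ ℝ ((Equiv.swap a b).prodCongr (Equiv.refl (Fin 3))) y) = -f i.succ y))) ∨
      (∃ kx : Fin 3,
        ((∀ y, f i.succ (LinearIsometryEquiv.piLpCongrRight 2
              (fun q : Fin 3 × Fin 3 => if q.1 = kx then LinearIsometryEquiv.neg ℝ (E := ℝ) else LinearIsometryEquiv.refl ℝ ℝ) y) = f i.succ y) ∧
            (∀ y, f l.succ (LinearIsometryEquiv.piLpCongrRight 2
              (fun q : Fin 3 × Fin 3 => if q.1 = kx then LinearIsometryEquiv.neg ℝ (E := ℝ) else LinearIsometryEquiv.refl ℝ ℝ) y) = -f l.succ y)) ∨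
          ((∀ y, f l.succ (LinearIsometryEquiv.piLpCongrRight 2
              (fun q : Fin 3 × Fin 3 => if q.1 = kx then LinearIsometryEquiv.neg ℝ (E := ℝ) else LinearIsometryEquiv.refl ℝ ℝ) y) = f l.succ y) ∧
            (∀ y, f i.succ (LinearIsometryEquiv.piLpCongrRight 2
              (fun q : Fin 3 × Fin 3 => if q.1 = kx then LinearIsometryEquiv.neg ℝ (E := ℝ) else LinearIsometryEquiv.refl ℝ ℝ) y) = -f i.succ y))) ∨
      (((∀ y, f i.succ (-y) = f i.succ y) ∧ (∀ y, f l.succ (-y) = -f l.succ y)) ∨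
        ((∀ y, f l.succ (-y) = f l.succ y) ∧ (∀ y, f i.succ (-y) = -f i.succ y))))
    {C : ℝ} (hC : 0 ≤ C) :
    StaticClauses k C β (dressedLiftFamily β φ (fun i => transplantObsL L Λ R f i)) := by
  have hbasis : TransplantBasisL k L Λ (fun i => transplantObsL L Λ R f i) := ⟨f, R, hf, hpos, hR1, hlo, hhi, fun _ => rfl⟩
  refine staticClauses_transplantL_of_pairSeparated hβ hvac hΛ hΛk hbasis (fun i l hil => ?_) hC
  rcases hcert i l hil with ⟨a, b, hab⟩ | ⟨kx, hk⟩ | hpar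
  · exact pairSeparated_transplantObsL_swap L Λ R hf hpos a b hab
  · exact pairSeparated_transplantObsL_reflect L Λ R hf hpos kx hk
  · exact pairSeparated_transplantObsL_parity L Λ R hf hpos hpar

end Summit.QuantumFields.YangMills.Theorems.FemtoTransferGap.PolyakovLift

end
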